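import Mathlib
import Summits.ResolutionOfSingularities.ResolutionOfSingularities.Theorems.WildQuotientsWildQuotientResolutionLinearSmallBlocksModel
import Summits.ResolutionOfSingularities.ResolutionOfSingularities.Theorems.WildQuotientsWildQuotientResolutionLinearSmallBlocksTrivial
import HarnessLib

/-!
# Rung LSB: every coordinate `ℤ/p`-action on `𝔸ⁿ` with Jordan blocks of size `≤ 2` has a resolvable quotient — all `D`

(crux stmt-ResolutionOfSingularities-15640 `WildQuotients.WildQuotientResolution`, line `Sketch`;
rung LSB of `L/w45c/CHAIN.md` v3, candidate (5) of `W45cPlanSignaturesV3.lean` VERBATIM — no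
non-emptiness hypothesis on `D`; [OURS · L1 W4.5c] — NOT a statement of any manuscript.)

`LinearSmallBlocks.hasResolution`: for `σ xᵢ = xᵢ + x_{f i}` (`i ∈ D`), `σ xᵢ = xᵢ` (`i ∉ D`),
`f(D) ∩ D = ∅`, the quotient `Spec k[x₀,…,x_{n-1}]^⟨σ⟩` has a resolution of singularities in every
characteristic `p` and every `n`: for `D = ∅` the action is trivial and the quotient is `𝔸ⁿ`
(`LinearSmallBlocks.hasResolution_of_empty`); for `D ≠ ∅` one equivariant blow-up of
`V(x_{f i} : i ∈ D)` is a Király–Lütkebohmert terminal model and the cyclic transfer applies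
(`LinearSmallBlocks.linearSmallBlocks_hasResolution`, res-L1-w45c-stub-2, on
`linearSmallBlocks_hasResolution_of_model`). Instances: programme T (`n = 4`, `D = {1,3}`),
`𝔸^{2m}/(J₂^{⊕m})` (non-Cohen–Macaulay for `m ≥ 3`), and — up to a linear change of coordinates
(`TameTransfer.hasResolution_fixedPoints_zpowers_conj`) — every linear `ℤ/2`-quotient of `𝔸ⁿ` in
characteristic `2`.
-/

-- single-problem summit: the doubled namespace component `ResolutionOfSingularities` is forced
set_option linter.dupNamespace false

noncomputable section

open MvPolynomial AlgebraicGeometry CategoryTheory Literature.AlgebraicGeometry.Resolution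

namespace Summit.ResolutionOfSingularities.ResolutionOfSingularities.Theorems.WildQuotientResolution.LinearSmallBlocks

/-- **Rung LSB, all `D`** (V3 (5) verbatim): every coordinate `ℤ/p`-action on `𝔸ⁿ_k` with Jordan
blocks of size `≤ 2` (`σ xᵢ = xᵢ + x_{f i}` on `D`, identity off `D`, `f(D) ∩ D = ∅`) has a quotient
`𝔸ⁿ/⟨σ⟩` admitting a resolution of singularities, in EVERY characteristic `p` and every dimension
`n` (`D = ∅`: the quotient is `𝔸ⁿ`; `D ≠ ∅`: terminal model + cyclic transfer).
[cite: KiralyLutkebohmert2013, Thm 2] [cite: SGA1, Exp. V, §1–2] -/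
theorem hasResolution (p : ℕ) (hp : p.Prime) (k : Type) [Field k] [CharP k p]
    (n : ℕ) (σ : MvPolynomial (Fin n) k ≃ₐ[k] MvPolynomial (Fin n) k)
    (D : Finset (Fin n)) (f : Fin n → Fin n) (hfD : ∀ i ∈ D, f i ∉ D)
    (hσD : ∀ i ∈ D, σ (X i) = X i + X (f i)) (hσ : ∀ i ∉ D, σ (X i) = X i) :
    Scheme.HasResolution
      (Spec (.of (FixedPoints.subalgebra k (MvPolynomial (Fin n) k) (Subgroup.zpowers σ)))) := by
  by_cases hD : D = ∅
  · exact hasResolution_of_empty k n σ D hσ hD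
  · exact linearSmallBlocks_hasResolution p hp k n σ D f hfD (Finset.nonempty_iff_ne_empty.mpr hD)
      hσD hσ

/-- Sanity instance (kernel-checked reduction, as in `W45cPlanSignaturesV3.lean`): programme T is
rung LSB at `n = 4`, `D = {1, 3}`, `f = (0, 0, 2, 2)`. [folklore] -/
example (p : ℕ) (hp : p.Prime) (k : Type) [Field k] [CharP k p]
    (σ : MvPolynomial (Fin 4) k ≃ₐ[k] MvPolynomial (Fin 4) k)
    (h0 : σ (X 0) = X 0) (h1 : σ (X 1) = X 1 + X 0)
    (h2 : σ (X 2) = X 2) (h3 : σ (X 3) = X 3 + X 2) :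
    Scheme.HasResolution
      (Spec (.of (FixedPoints.subalgebra k (MvPolynomial (Fin 4) k) (Subgroup.zpowers σ)))) := by
  refine hasResolution p hp k 4 σ {1, 3} ![0, 0, 2, 2] ?_ ?_ ?_
  · decide
  · intro i hi
    fin_cases i <;> simp_all
  · intro i hi
    fin_cases i <;> simp_all

end Summit.ResolutionOfSingularities.ResolutionOfSingularities.Theorems.WildQuotientResolution.LinearSmallBlocks

end
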